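import Summits.RiemannHypothesis.RiemannHypothesis.Theorems.SpectralTraceFloorFeedbackDefs
import Literature.NumberTheory.LFunctions.WeilMellinInversion
import Literature.NumberTheory.LFunctions.SelbergArgOmegaKernel
import Mathlib.MeasureTheory.Integral.Prod
import HarnessLib

/-!
# The explicit window density realises `W` on `[-A, A]` (`stub_modelDensity`)

Route `RiemannHypothesis/SpectralTrace`, crux `WindowStep` (stmt-RiemannHypothesis-14659), line
`floor-feedback` (definitions `Theorems/SpectralTraceFloorFeedbackDefs.lean`), stub `stub_modelDensity`.

**What is proved.** For `A > 0` the explicit real density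
`ρ_A(T) = θ'(T)/π + p_A(T) − (1/π) Σ_{log m < A} Λ(m) m^{-1/2} cos(T log m)` (`modelDensity A`,
`θ' = riemannSiegelThetaDeriv`, `p_A = polarKernel A`) is a window density at level `A`
(`IsWindowDensity A (modelDensity A)`): for every Weil test `g` supported in `[-A, A]`,
`T ↦ ĝ(1/2 + iT) ρ_A(T)` is integrable and `∫ ĝ(1/2 + iT) ρ_A(T) dT = W(g) = weilFunctional g`
(`ĝ = weilMellin g`, `ĝ(1/2 + iT) = ∫ g(t) e^{iTt} dt`).

**Proof.** Three pieces, each of the shape "integrable ∧ integral = …", added at the end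
(`W = polar − prime + arch`).
* Mellin inversion on the critical line (`weilMellin_inversion` at `c = 1/2`, Bombieri 2000 §2):
  `∫ ĝ(1/2 + iy) cos(yx) dy = π (g(x) + g(−x))` for every real `x` (`stub_modelDensity_cos`).
* Archimedean piece (`stub_modelDensity_arch`): `θ' = Re ψ(1/4 + iT/2)/2 − (log π)/2`, so
  `∫ ĝ θ'/π = (1/2π) ∫ ĝ Re ψ − (log π/2π) ∫ ĝ = (1/2π)·weilArchIntegral g − g(0) log π = weilArchTerm g`
  (`integral_weilMellin_vertical`; integrability from `|θ'(T)| ≤ C(1 + |T|)`,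
  `integrable_mul_weilMellin_vertical_of_norm_le_linear`).
* Prime piece (`stub_modelDensity_prime`): by the cosine identity at `x = log m`,
  `(1/π) Σ_{log m < A} Λ(m) m^{-1/2} ∫ ĝ cos(T log m) dT = Σ_{log m < A} Λ(m) m^{-1/2} (g(log m) + g(−log m))`,
  which is the whole prime sum `weilPrimeTerm g` since `g(±log m) = 0` once `log m ≥ A`
  (`supp g ⊆ (−A, A)`, `support_subset_Ioo_of_tsupport_subset_Icc`, `mem_weilPrimeIndex`).
* Polar piece (`stub_modelDensity_polar`, stated for any continuous compactly supported cutoff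
  `χ ≡ 1` on `[-A, A]`): with `G(t) = 2cosh(t/2) χ(t)`, Fubini and the cosine identity give
  `∫ ĝ(1/2+iT) (1/2π) ∫ G(t) cos(tT) dt dT = (1/2π) ∫ G(t) π (g(t) + g(−t)) dt = ∫ 2cosh(t/2) g(t) dt`
  (`χ = 1` wherever `g ≠ 0`, and `t ↦ −t`), `= ĝ(0) + ĝ(1)` (`e^{−t/2} + e^{t/2} = 2cosh(t/2)`).
  For `χ = windowCutoff A` (`≡ 1` on the closed ball of radius `|A| + 1 ⊇ [-A, A]`) this is the
  polar kernel `p_A`.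

References: E. Bombieri, *Remarks on Weil's quadratic functional in the theory of prime numbers I*,
Rend. Mat. Acc. Lincei (9) 11 (2000), Thm 2 and §2 (inverse Mellin transform on vertical lines);
H. Iwaniec, E. Kowalski, *Analytic Number Theory* (2004), Thm 5.12. All ingredients are proved
tree / Mathlib facts.
-/

set_option linter.dupNamespace false

noncomputable section

open Complex Filter Set MeasureTheory
open scoped Real Topology BigOperators FourierTransform SchwartzMap

namespace Summit.RiemannHypothesis.RiemannHypothesis.Theorems.SpectralTraceWindowStep

open Literature.NumberTheory.LFunctions
open Summit.RiemannHypothesis.RiemannHypothesis.Theorems.FloorFeedback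

variable {g : ℝ → ℂ}

/-! ## Mellin inversion on the critical line -/

/-- `(1/2 : ℝ) + iy = 1/2 + iy` in `ℂ` (cast bookkeeping for the line `Re s = 1/2`). [folklore] -/
theorem stub_modelDensity_half_cast (y : ℝ) : ((1 / 2 : ℝ) : ℂ) + y * I = 1 / 2 + y * I := by
  push_cast; ring

/-- `y ↦ ĝ(1/2 + iy)` is integrable (`integrable_weilMellin_vertical` at `c = 1/2`). [folklore] -/
theorem stub_modelDensity_integrable_vertical (hg : IsWeilTest g) :
    Integrable fun y : ℝ => weilMellin g (1 / 2 + y * I) := by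
  simpa only [stub_modelDensity_half_cast] using integrable_weilMellin_vertical hg (1 / 2)

/-- `∫ ĝ(1/2 + iy) dy = 2π g(0)` (`integral_weilMellin_vertical` at `c = 1/2`). [folklore] -/
theorem stub_modelDensity_integral_vertical (hg : IsWeilTest g) :
    ∫ y : ℝ, weilMellin g (1 / 2 + y * I) = 2 * π * g 0 := by
  simpa only [stub_modelDensity_half_cast] using integral_weilMellin_vertical hg (1 / 2)

/-- Integrability of `y ↦ ĝ(1/2 + iy) Φ(y)` for a continuous bounded factor `Φ`
(`integrable_weilMellin_vertical_mul`). [folklore] -/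
theorem stub_modelDensity_integrable_mul (hg : IsWeilTest g) {Φ : ℝ → ℂ} (hΦ : Continuous Φ)
    {B : ℝ} (hB : ∀ y, ‖Φ y‖ ≤ B) :
    Integrable fun y : ℝ => weilMellin g (1 / 2 + y * I) * Φ y := by
  simpa only [stub_modelDensity_half_cast] using integrable_weilMellin_vertical_mul hg (1 / 2) hΦ hB

/-- Integrability of `y ↦ ĝ(1/2 + iy) e^{-iyx}`. [folklore] -/
theorem stub_modelDensity_integrable_exp (hg : IsWeilTest g) (x : ℝ) :
    Integrable fun y : ℝ => weilMellin g (1 / 2 + y * I) * cexp (-(y * I) * x) :=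
  stub_modelDensity_integrable_mul hg (by fun_prop) (B := 1) fun y => by
    rw [show -(y * I : ℂ) * (x : ℂ) = ((-(y * x) : ℝ) : ℂ) * I by push_cast; ring,
      Complex.norm_exp_ofReal_mul_I]

/-- Mellin inversion at `c = 1/2` (Bombieri 2000 §2, `weilMellin_inversion`):
`∫ ĝ(1/2 + iy) e^{-iyx} dy = 2π g(x)`. [folklore] -/
theorem stub_modelDensity_inversion (hg : IsWeilTest g) (x : ℝ) :
    ∫ y : ℝ, weilMellin g (1 / 2 + y * I) * cexp (-(y * I) * x) = 2 * π * g x := by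
  have h := weilMellin_inversion hg (1 / 2) x
  have e0 : ((1 / 2 : ℝ) : ℂ) - 1 / 2 = 0 := by push_cast; ring
  simp only [e0, zero_mul, Complex.exp_zero, mul_one, stub_modelDensity_half_cast] at h
  exact h

/-- **The cosine identity on the critical line**: for a Weil test `g` and every real `x`,
`∫ ĝ(1/2 + iy) cos(yx) dy = π (g(x) + g(−x))` (`2cos(yx) = e^{-iyx} + e^{iyx}` and Mellin inversion
at `±x`). [folklore] -/
theorem stub_modelDensity_cos (hg : IsWeilTest g) (x : ℝ) :
    ∫ y : ℝ, weilMellin g (1 / 2 + y * I) * (Real.cos (y * x) : ℂ) = π * (g x + g (-x)) := by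
  have hsum : (∫ y : ℝ, weilMellin g (1 / 2 + y * I) * (2 * (Real.cos (y * x) : ℂ))) =
      2 * π * g x + 2 * π * g (-x) := by
    rw [← stub_modelDensity_inversion hg x, ← stub_modelDensity_inversion hg (-x),
      ← integral_add (stub_modelDensity_integrable_exp hg x)
        (stub_modelDensity_integrable_exp hg (-x))]
    congr 1 with y
    rw [← mul_add]
    congr 1
    have e1 : -(y * I : ℂ) * (x : ℂ) = -((y * x : ℝ) : ℂ) * I := by push_cast; ring
    have e2 : -(y * I : ℂ) * ((-x : ℝ) : ℂ) = ((y * x : ℝ) : ℂ) * I := by push_cast; ring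
    rw [e1, e2, add_comm, ← Complex.two_cos, Complex.ofReal_cos]
  have h2 : (∫ y : ℝ, weilMellin g (1 / 2 + y * I) * (2 * (Real.cos (y * x) : ℂ))) =
      2 * ∫ y : ℝ, weilMellin g (1 / 2 + y * I) * (Real.cos (y * x) : ℂ) := by
    rw [← integral_const_mul]
    congr 1 with y
    ring
  apply mul_left_cancel₀ (two_ne_zero' ℂ)
  rw [← h2, hsum]
  ring

/-! ## The prime piece -/

/-- A Weil test supported in `[-A, A]` vanishes at `|x| ≥ A` (its support is open, hence inside
`(-A, A)`). [folklore] -/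
theorem stub_modelDensity_apply_eq_zero (hg : IsWeilTest g) {A x : ℝ}
    (hsupp : tsupport g ⊆ Icc (-A) A) (hx : A ≤ |x|) : g x = 0 := by
  by_contra hne
  have hmem := support_subset_Ioo_of_tsupport_subset_Icc hg.1.continuous hsupp
    (Function.mem_support.2 hne)
  have : |x| < A := abs_lt.2 ⟨hmem.1, hmem.2⟩
  linarith

/-- For a Weil test supported in `[-A, A]` the prime sum is the finite sum over
`weilPrimeIndex (A/2) = {m : log m < A}`. [folklore] -/
theorem stub_modelDensity_primeTerm (hg : IsWeilTest g) {A : ℝ} (hsupp : tsupport g ⊆ Icc (-A) A) :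
    weilPrimeTerm g = ∑ m ∈ weilPrimeIndex (A / 2),
      ((ArithmeticFunction.vonMangoldt m : ℝ) : ℂ) / (Real.sqrt m : ℂ) *
        (g (Real.log m) + g (-Real.log m)) := by
  refine tsum_eq_sum fun n hn => ?_
  rw [mem_weilPrimeIndex, not_lt] at hn
  have hA : A ≤ Real.log n := by linarith
  have h0 : 0 ≤ Real.log n := Real.log_natCast_nonneg n
  rw [stub_modelDensity_apply_eq_zero hg hsupp (by rwa [abs_of_nonneg h0]),
    stub_modelDensity_apply_eq_zero hg hsupp (by rwa [abs_neg, abs_of_nonneg h0]),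
    add_zero, mul_zero]

/-- **The prime piece.** For a Weil test `g` supported in `[-A, A]`,
`∫ ĝ(1/2 + iT) · (1/π) Σ_{log m < A} Λ(m) m^{-1/2} cos(T log m) dT = Σₘ Λ(m) m^{-1/2}(g(log m) + g(−log m))`
(with integrability). [folklore] -/
theorem stub_modelDensity_prime (hg : IsWeilTest g) {A : ℝ} (hsupp : tsupport g ⊆ Icc (-A) A) :
    Integrable (fun T : ℝ => weilMellin g (1 / 2 + T * I) *
      ((1 / π * ∑ m ∈ weilPrimeIndex (A / 2), (ArithmeticFunction.vonMangoldt m : ℝ) /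
        Real.sqrt m * Real.cos (T * Real.log m) : ℝ) : ℂ)) ∧
    ∫ T : ℝ, weilMellin g (1 / 2 + T * I) *
      ((1 / π * ∑ m ∈ weilPrimeIndex (A / 2), (ArithmeticFunction.vonMangoldt m : ℝ) /
        Real.sqrt m * Real.cos (T * Real.log m) : ℝ) : ℂ) = weilPrimeTerm g := by
  have hterm : ∀ m : ℕ, Integrable fun T : ℝ =>
      weilMellin g (1 / 2 + T * I) * (Real.cos (T * Real.log m) : ℂ) := fun m =>
    stub_modelDensity_integrable_mul hg (by fun_prop) (B := 1) fun T => by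
      rw [Complex.norm_real, Real.norm_eq_abs]; exact Real.abs_cos_le_one _
  have hexp : (fun T : ℝ => weilMellin g (1 / 2 + T * I) *
      ((1 / π * ∑ m ∈ weilPrimeIndex (A / 2), (ArithmeticFunction.vonMangoldt m : ℝ) /
        Real.sqrt m * Real.cos (T * Real.log m) : ℝ) : ℂ)) =
      fun T : ℝ => ∑ m ∈ weilPrimeIndex (A / 2),
        ((1 / π * ((ArithmeticFunction.vonMangoldt m : ℝ) / Real.sqrt m) : ℝ) : ℂ) *
          (weilMellin g (1 / 2 + T * I) * (Real.cos (T * Real.log m) : ℂ)) := by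
    funext T
    rw [Complex.ofReal_mul, Complex.ofReal_sum, Finset.mul_sum, Finset.mul_sum]
    refine Finset.sum_congr rfl fun m _ => ?_
    push_cast
    ring
  rw [hexp]
  refine ⟨integrable_finsetSum _ fun m _ => (hterm m).const_mul _, ?_⟩
  rw [integral_finsetSum _ fun m _ => (hterm m).const_mul _, stub_modelDensity_primeTerm hg hsupp]
  refine Finset.sum_congr rfl fun m _ => ?_
  rw [integral_const_mul, stub_modelDensity_cos hg (Real.log m)]
  have hπ : (π : ℂ) ≠ 0 := Complex.ofReal_ne_zero.2 Real.pi_ne_zero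
  push_cast
  field_simp

/-! ## The archimedean piece -/

/-- `T ↦ ĝ(1/2 + iT) θ'(T)` is integrable (`|θ'(T)| ≤ C(1 + |T|)` against the decay of `ĝ`). [folklore] -/
theorem stub_modelDensity_integrable_theta (hg : IsWeilTest g) :
    Integrable fun T : ℝ => weilMellin g (1 / 2 + T * I) * (riemannSiegelThetaDeriv T : ℂ) := by
  obtain ⟨C, -, hC⟩ := SelbergOmega.exists_abs_riemannSiegelThetaDeriv_le
  have h := integrable_mul_weilMellin_vertical_of_norm_le_linear hg (1 / 2)
    (F := fun T : ℝ => (riemannSiegelThetaDeriv T : ℂ))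
    (Complex.continuous_ofReal.comp continuous_riemannSiegelThetaDeriv_holds) (C := C)
    fun y => by rw [Complex.norm_real, Real.norm_eq_abs]; exact hC y
  refine h.congr (Eventually.of_forall fun T => ?_)
  show (riemannSiegelThetaDeriv T : ℂ) * weilMellin g ((1 / 2 : ℝ) + T * I) = _
  rw [stub_modelDensity_half_cast, mul_comm]

/-- **The archimedean piece.** For a Weil test `g`,
`∫ ĝ(1/2 + iT) θ'(T)/π dT = (1/2π) ∫ ĝ(1/2 + iT) Re ψ(1/4 + iT/2) dT − g(0) log π = weilArchTerm g`
(with integrability). [folklore] -/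
theorem stub_modelDensity_arch (hg : IsWeilTest g) :
    Integrable (fun T : ℝ => weilMellin g (1 / 2 + T * I) *
      ((riemannSiegelThetaDeriv T / π : ℝ) : ℂ)) ∧
    ∫ T : ℝ, weilMellin g (1 / 2 + T * I) * ((riemannSiegelThetaDeriv T / π : ℝ) : ℂ) =
      weilArchTerm g := by
  have hθ := stub_modelDensity_integrable_theta hg
  have hF := stub_modelDensity_integrable_vertical hg
  have hπ : (π : ℂ) ≠ 0 := Complex.ofReal_ne_zero.2 Real.pi_ne_zero
  have hexp : (fun T : ℝ => weilMellin g (1 / 2 + T * I) *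
      ((riemannSiegelThetaDeriv T / π : ℝ) : ℂ)) = fun T : ℝ =>
        (1 / π : ℂ) * (weilMellin g (1 / 2 + T * I) * (riemannSiegelThetaDeriv T : ℂ)) := by
    funext T
    push_cast
    field_simp
  rw [hexp, integral_const_mul]
  refine ⟨hθ.const_mul _, ?_⟩
  have hI : weilArchIntegral g =
      2 * (∫ T : ℝ, weilMellin g (1 / 2 + T * I) * (riemannSiegelThetaDeriv T : ℂ)) +
        (Real.log π : ℂ) * (2 * π * g 0) := by
    unfold weilArchIntegral
    rw [← stub_modelDensity_integral_vertical hg, ← integral_const_mul, ← integral_const_mul,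
      ← integral_add (hθ.const_mul _) (hF.const_mul _)]
    congr 1 with T
    rw [SelbergOmega.re_digamma_quarter_eq]
    push_cast
    ring
  have key : ∀ X g0 L p : ℂ, p ≠ 0 →
      1 / p * X = 1 / (2 * p) * (2 * X + L * (2 * p * g0)) - g0 * L := by
    intro X g0 L p hp
    field_simp
    ring
  unfold weilArchTerm
  rw [hI]
  exact key _ _ _ _ hπ

/-! ## The polar piece -/

/-- **The polar piece.** For a Weil test `g` supported in `[-A, A]` and any continuous compactly
supported real cutoff `χ ≡ 1` on `[-A, A]`, the density `p(T) = (1/2π) ∫ 2cosh(t/2) χ(t) cos(tT) dt`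
represents the polar term: `∫ ĝ(1/2 + iT) p(T) dT = ĝ(0) + ĝ(1)` (with integrability; Fubini, the
cosine identity, `χ = 1` on the support of `g`, and `e^{-t/2} + e^{t/2} = 2cosh(t/2)`). [folklore] -/
theorem stub_modelDensity_polar (hg : IsWeilTest g) {A : ℝ} (hsupp : tsupport g ⊆ Icc (-A) A)
    {χ : ℝ → ℝ} (hχ : Continuous χ) (hχs : HasCompactSupport χ)
    (hχ1 : ∀ t ∈ Icc (-A) A, χ t = 1) :
    Integrable (fun T : ℝ => weilMellin g (1 / 2 + T * I) *
      ((1 / (2 * π) * ∫ t : ℝ, 2 * Real.cosh (t / 2) * χ t * Real.cos (t * T) : ℝ) : ℂ)) ∧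
    ∫ T : ℝ, weilMellin g (1 / 2 + T * I) *
      ((1 / (2 * π) * ∫ t : ℝ, 2 * Real.cosh (t / 2) * χ t * Real.cos (t * T) : ℝ) : ℂ) =
      weilMellin g 0 + weilMellin g 1 := by
  have hgc : Continuous g := hg.1.continuous
  have hcont : Continuous (weilMellin g) := continuous_weilMellin hgc hg.2
  have hF := stub_modelDensity_integrable_vertical hg
  -- the weight `G = 2cosh(t/2) χ`
  have hGc : Continuous fun t : ℝ => 2 * Real.cosh (t / 2) * χ t := by fun_prop
  have hGs : HasCompactSupport fun t : ℝ => 2 * Real.cosh (t / 2) * χ t := hχs.mul_left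
  have hGi : Integrable fun t : ℝ => ((2 * Real.cosh (t / 2) * χ t : ℝ) : ℂ) :=
    (Complex.continuous_ofReal.comp hGc).integrable_of_hasCompactSupport
      (hGs.comp_left Complex.ofReal_zero)
  -- Fubini
  have hH : Integrable (Function.uncurry fun (T : ℝ) (t : ℝ) =>
      weilMellin g (1 / 2 + T * I) * ((2 * Real.cosh (t / 2) * χ t * Real.cos (t * T) : ℝ) : ℂ))
      ((volume : Measure ℝ).prod volume) := by
    refine Integrable.mono' (hF.mul_prod hGi).norm ?_ (Eventually.of_forall fun p => ?_)
    · exact (by fun_prop : Continuous (Function.uncurry fun (T : ℝ) (t : ℝ) =>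
        weilMellin g (1 / 2 + T * I) *
          ((2 * Real.cosh (t / 2) * χ t * Real.cos (t * T) : ℝ) : ℂ))).aestronglyMeasurable
    · obtain ⟨T, t⟩ := p
      simp only [Function.uncurry_apply_pair, norm_mul, Complex.norm_real, Real.norm_eq_abs]
      exact mul_le_mul_of_nonneg_left
        (mul_le_of_le_one_right (by positivity) (Real.abs_cos_le_one _)) (norm_nonneg _)
  have hrew : (fun T : ℝ => weilMellin g (1 / 2 + T * I) *
      ((1 / (2 * π) * ∫ t : ℝ, 2 * Real.cosh (t / 2) * χ t * Real.cos (t * T) : ℝ) : ℂ)) =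
      fun T : ℝ => ((1 / (2 * π) : ℝ) : ℂ) * ∫ t : ℝ, weilMellin g (1 / 2 + T * I) *
        ((2 * Real.cosh (t / 2) * χ t * Real.cos (t * T) : ℝ) : ℂ) := by
    funext T
    rw [integral_const_mul (weilMellin g (1 / 2 + T * I)), integral_complex_ofReal,
      Complex.ofReal_mul]
    ring
  rw [hrew, integral_const_mul ((1 / (2 * π) : ℝ) : ℂ), integral_integral_swap hH]
  refine ⟨hH.integral_prod_left.const_mul _, ?_⟩
  -- the inner integral, by the cosine identity
  have inner : ∀ t : ℝ, (∫ T : ℝ, weilMellin g (1 / 2 + T * I) *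
      ((2 * Real.cosh (t / 2) * χ t * Real.cos (t * T) : ℝ) : ℂ)) =
      ((2 * Real.cosh (t / 2) * χ t : ℝ) : ℂ) * (π * (g t + g (-t))) := by
    intro t
    rw [← stub_modelDensity_cos hg t, ← integral_const_mul]
    congr 1 with T
    rw [mul_comm t T]
    push_cast
    ring
  simp_rw [inner]
  -- `χ = 1` wherever `g ≠ 0`
  have hχg : ∀ t : ℝ, (χ t : ℂ) * g t = g t := by
    intro t
    by_cases h : g t = 0
    · rw [h, mul_zero]
    · rw [hχ1 t (hsupp (subset_tsupport _ (Function.mem_support.2 h))), Complex.ofReal_one,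
        one_mul]
  have hχg' : ∀ t : ℝ, (χ t : ℂ) * g (-t) = g (-t) := by
    intro t
    by_cases h : g (-t) = 0
    · rw [h, mul_zero]
    · have hmem : -t ∈ Icc (-A) A := hsupp (subset_tsupport _ (Function.mem_support.2 h))
      have ht : t ∈ Icc (-A) A := ⟨by linarith [hmem.2], by linarith [hmem.1]⟩
      rw [hχ1 t ht, Complex.ofReal_one, one_mul]
  have hpt : ∀ t : ℝ, ((2 * Real.cosh (t / 2) * χ t : ℝ) : ℂ) * (π * (g t + g (-t))) =
      (π : ℂ) * (((2 * Real.cosh (t / 2) : ℝ) : ℂ) * g t) +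
        (π : ℂ) * (((2 * Real.cosh (-t / 2) : ℝ) : ℂ) * g (-t)) := by
    intro t
    rw [neg_div, Real.cosh_neg]
    calc _ = (π : ℂ) * ((2 * Real.cosh (t / 2) : ℝ) : ℂ) *
          ((χ t : ℂ) * g t + (χ t : ℂ) * g (-t)) := by push_cast; ring
      _ = _ := by rw [hχg, hχg']; ring
  have hwi : Integrable fun t : ℝ => ((2 * Real.cosh (t / 2) : ℝ) : ℂ) * g t :=
    ((by fun_prop : Continuous fun t : ℝ => ((2 * Real.cosh (t / 2) : ℝ) : ℂ)).mul
      hgc).integrable_of_hasCompactSupport hg.2.mul_left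
  have hwi' : Integrable fun t : ℝ => ((2 * Real.cosh (-t / 2) : ℝ) : ℂ) * g (-t) := hwi.comp_neg
  simp_rw [hpt]
  rw [integral_add (hwi.const_mul _) (hwi'.const_mul _), integral_const_mul, integral_const_mul,
    integral_neg_eq_self (fun t : ℝ => ((2 * Real.cosh (t / 2) : ℝ) : ℂ) * g t)]
  -- `∫ 2cosh(t/2) g(t) dt = ĝ(0) + ĝ(1)`
  have hX : (∫ t : ℝ, ((2 * Real.cosh (t / 2) : ℝ) : ℂ) * g t) = weilMellin g 0 + weilMellin g 1 := by
    unfold weilMellin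
    rw [← integral_add (integrable_weilIntegrand hgc hg.2 0) (integrable_weilIntegrand hgc hg.2 1)]
    congr 1 with t
    have e1 : ((0 : ℂ) - 1 / 2) * t = -((t : ℂ) / 2) := by ring
    have e2 : ((1 : ℂ) - 1 / 2) * t = (t : ℂ) / 2 := by ring
    rw [e1, e2, Complex.ofReal_mul, Complex.ofReal_cosh, Complex.ofReal_ofNat, Complex.two_cosh]
    push_cast
    ring
  rw [hX]
  have key : ∀ S p : ℂ, p ≠ 0 → 1 / (2 * p) * (p * S + p * S) = S := by
    intro S p hp
    field_simp
    ring
  push_cast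
  exact key _ _ (Complex.ofReal_ne_zero.2 Real.pi_ne_zero)

/-! ## The registered stub -/

/-- The window cutoff `χ_A` is `≡ 1` on `[-A, A]` (it is `1` on the closed ball of radius `|A| + 1`).
[folklore] -/
theorem stub_modelDensity_windowCutoff_one {A t : ℝ} (ht : t ∈ Icc (-A) A) :
    windowCutoff A t = 1 := by
  apply (windowCutoff A).one_of_mem_closedBall
  rw [Metric.mem_closedBall, dist_zero_right, Real.norm_eq_abs]
  show |t| ≤ |A| + 1
  have : |t| ≤ A := abs_le.2 ⟨ht.1, ht.2⟩
  linarith [le_abs_self A]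

/-- **stub_modelDensity — the explicit window density realises `W` on `[-A, A]`.** For `A > 0`,
`ρ_A = θ'/π + p_A − (1/π) Σ_{log m < A} Λ(m) m^{-1/2} cos(T log m)` (`modelDensity A`) satisfies
`IsWindowDensity A ρ_A`: for every Weil test `g` supported in `[-A, A]`, `T ↦ ĝ(1/2 + iT) ρ_A(T)` is
integrable and `∫ ĝ(1/2 + iT) ρ_A(T) dT = W(g)` (the explicit formula's right side
`W = polar − prime + arch` written as one integral on the critical line: `stub_modelDensity_arch`,
`stub_modelDensity_polar` with `χ = windowCutoff A`, `stub_modelDensity_prime`). [folklore] -/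
theorem stub_modelDensity : ∀ A : ℝ, 0 < A → IsWindowDensity A (modelDensity A) := by
  intro A _ g hg hsupp
  have harch := stub_modelDensity_arch hg
  have hprime := stub_modelDensity_prime hg hsupp
  have hpolar := stub_modelDensity_polar hg hsupp (windowCutoff A).continuous
    (windowCutoff A).hasCompactSupport fun t ht => stub_modelDensity_windowCutoff_one ht
  have hρ : ∀ T : ℝ, weilMellin g (1 / 2 + (T : ℂ) * I) * ((modelDensity A T : ℝ) : ℂ) =
      weilMellin g (1 / 2 + T * I) * ((riemannSiegelThetaDeriv T / π : ℝ) : ℂ) +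
        weilMellin g (1 / 2 + T * I) * ((1 / (2 * π) * ∫ t : ℝ, 2 * Real.cosh (t / 2) *
          windowCutoff A t * Real.cos (t * T) : ℝ) : ℂ) -
        weilMellin g (1 / 2 + T * I) * ((1 / π * ∑ m ∈ weilPrimeIndex (A / 2),
          (ArithmeticFunction.vonMangoldt m : ℝ) / Real.sqrt m * Real.cos (T * Real.log m) : ℝ) : ℂ) := by
    intro T
    simp only [modelDensity, polarKernel, Complex.ofReal_add, Complex.ofReal_sub]
    ring
  have hadd : Integrable fun T : ℝ =>
      weilMellin g (1 / 2 + T * I) * ((riemannSiegelThetaDeriv T / π : ℝ) : ℂ) +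
        weilMellin g (1 / 2 + T * I) * ((1 / (2 * π) * ∫ t : ℝ, 2 * Real.cosh (t / 2) *
          windowCutoff A t * Real.cos (t * T) : ℝ) : ℂ) := harch.1.add hpolar.1
  simp_rw [hρ]
  refine ⟨hadd.sub hprime.1, ?_⟩
  rw [integral_sub hadd hprime.1, integral_add harch.1 hpolar.1, harch.2, hpolar.2, hprime.2]
  unfold weilFunctional weilPolarTerm
  ring

end Summit.RiemannHypothesis.RiemannHypothesis.Theorems.SpectralTraceWindowStep

end
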